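import Summits.Ventures.Crystal3D.TopCut.X2SOSCheck
import HarnessLib

/-!
# X2 cap certificates by sum-of-squares identities, III: soundness

Venture `Crystal3D` (cell `pub-crystal3d`, phase 2; seat p2). For an `X2Cert` `c` (seat p1,
`Bulk/CapX2Cert.lean`), an `X2SOSCert` passing `check2`/`check3`, the bridges and the side conditions,
with validated Gram expansions (`ThreePointCert.RValid`), a validated cap expansion
(`CapSOS.CapFValid`, `CapSOS.linkCheck` on `c.cap`) and validated pole expansions (`PolePValid`,
`PoleSValid`, `linkCheckX`), proves the two trivariate inequalities of the certificate:
`ineqII_of_x2sos : … → c.IneqII (1/2) lam` and `ineqIII_of_x2sos : … → c.IneqIII (1/2) eps3`;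
with (N) and (I) (p1's rational / Taylor-box checks) `noHole_of_x2sos : … → NoHole (-c.u₀)`
(via p1's `noHole_of_x2Cert`). On the domain every multiplier is `≥ 0`, the Gram expansions are
`≥ 0`, so the identity gives `PpI ≤ CI2` (resp. `SpI ≤ CI3`) pointwise; the bridge and the link transfer
this to `P` (resp. `S₃`). Standard axioms only.
HONEST FRAMING: soundness of a checker [folklore]; NO certificate is asserted here.
-/

noncomputable section

open Finset
open Literature.Geometry.DiscreteGeometry Literature.Geometry.DiscreteGeometry.PolyCert
open Literature.Geometry.DiscreteGeometry.PolyCert.SPoly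
open Literature.Geometry.DiscreteGeometry.BachocVallentin
open Literature.Analysis.SpecialFunctions
open Summit.Ventures.PackingBounds.ThreePointCert
open Summit.Ventures.Crystal3D.CapSOS Summit.Ventures.Crystal3D.CapX2

namespace Summit.Ventures.Crystal3D.X2SOS

/-! ### Soundness -/

/-- `|x| ≤ 1` for `x ∈ [-1, 1/2]`. [folklore] -/
theorem abs_le_one_of_R3 (x : ℝ) (h1 : -1 ≤ x) (h2 : x ≤ ((1 / 2 : ℚ) : ℝ)) : |x| ≤ 1 := by
  rw [abs_le]; push_cast at h2; exact ⟨h1, by linarith⟩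

/-- `n_x = (1+x)(1-2x) ≥ 0` on `[-1, 1/2]`. [folklore] -/
theorem ptMult_nonneg (x : ℝ) (h1 : -1 ≤ x) (h2 : x ≤ ((1 / 2 : ℚ) : ℝ)) : 0 ≤ (1 + x) * (1 - 2 * x) := by
  push_cast at h2; exact mul_nonneg (by linarith) (by linarith)

/-- The value of the full pair expansion `KI ++ PI` is `DK · P`. [folklore] -/
theorem eval_pair_expansion (c : X2Cert) (LK : CapLink) (L : X2Link) (DK : ℕ) (KI PI : SPoly)
    (hK : linkCheck c.cap LK DK = true) (hKI : CapFValid (LK.blocks c.cap.L.length c.cap.R) KI)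
    (hX : linkCheckX c L DK = true) (hPI : PolePValid (L.blocks c.KX c.RX) PI)
    (u v t : ℝ) (hu : |u| ≤ 1) (hv : |v| ≤ 1) (ht : |t| ≤ 1) :
    eval (KI ++ PI) u v t = (DK : ℝ) * c.pairPoly u v t := by
  rw [eval_append, hKI u v t hu hv ht, hPI u v t hu hv ht, capFval_link c.cap LK DK hK,
    polePval_link c L DK hX]
  rw [X2Cert.kernel]; ring

set_option maxHeartbeats 800000 in
/-- **Soundness of (II)**: an `X2SOSCert` passing `check2`, `bridge2` and `side2`, with validated Gram
expansions and validated cap and pole expansions, proves `c.IneqII (1/2) lam`. [folklore] -/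
theorem ineqII_of_x2sos (c : X2Cert) (LK : CapLink) (L : X2Link) (DK : ℕ) (KI PI : SPoly)
    (S : X2SOSCert) (g0 g1 g2 g3 g4 : GramBlk) (lam : ℚ)
    (hK : linkCheck c.cap LK DK = true) (hKI : CapFValid (LK.blocks c.cap.L.length c.cap.R) KI)
    (hX : linkCheckX c L DK = true) (hPI : PolePValid (L.blocks c.KX c.RX) PI)
    (h0 : RValid g0 S.E0) (h1 : RValid g1 S.E1) (h2 : RValid g2 S.E2) (h3 : RValid g3 S.E3)
    (h4 : RValid g4 S.E4) (hb : S.bridge2 DK (KI ++ PI) = true) (hc : S.check2 = true)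
    (hs : S.side2 c DK lam = true) : c.IneqII (1 / 2) lam := by
  simp only [X2SOSCert.side2, Bool.and_eq_true, decide_eq_true_eq] at hs
  obtain ⟨⟨⟨⟨⟨hq, hpq⟩, hu0⟩, hDK⟩, hl2⟩, hlam⟩ := hs
  intro u v t hu hu' hv hv' ht ht' hgram
  have hu0R : ((c.u0 : ℚ) : ℝ) = -(S.p0 : ℝ) / S.q0 := by rw [hu0]; push_cast; ring
  rw [hu0R] at hu hv
  have hu1 := abs_le_one_of_cap S.p0 S.q0 hq hpq u hu hu'
  have hv1 := abs_le_one_of_cap S.p0 S.q0 hq hpq v hv hv'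
  have ht1 : |t| ≤ 1 := abs_le.2 ⟨ht, by push_cast at ht'; linarith⟩
  have gu := mIu_nonneg S.p0 S.q0 hq u hu hu'
  have gv := mIu_nonneg S.p0 S.q0 hq v hv hv'
  have gt : 0 ≤ (1 + t) * (1 - 2 * t) := mul_nonneg (by linarith) (by push_cast at ht'; linarith)
  have hres := abs_eval_le_of_residualBound _ _ hc hu1 hv1 ht1
  rw [eval_mergeAll] at hres
  simp only [List.map_cons, List.map_nil, List.sum_cons, List.sum_nil, add_zero, eval_neg, eval_C,
    Int.cast_natCast] at hres
  have hrhs : 0 ≤ eval S.rhs2 u v t := by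
    have e0 := eval_nonneg_of_rvalid g0 S.E0 h0 u v t hu1 hv1 ht1
    have e1 := eval_nonneg_of_rvalid g1 S.E1 h1 u v t hu1 hv1 ht1
    have e2 := eval_nonneg_of_rvalid g2 S.E2 h2 u v t hu1 hv1 ht1
    have e3 := eval_nonneg_of_rvalid g3 S.E3 h3 u v t hu1 hv1 ht1
    have e4 := eval_nonneg_of_rvalid g4 S.E4 h4 u v t hu1 hv1 ht1
    rw [X2SOSCert.rhs2, eval_mergeAll]
    simp only [List.map_cons, List.map_nil, List.sum_cons, List.sum_nil, add_zero, eval_mulN,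
      eval_append, eval_permBAC, X2SOSCert.eval_mIu, eval_ptT, eval_p4]
    generalize eval S.E0 u v t = r0 at *
    generalize eval S.E1 u v t = r1 at *
    generalize eval S.E2 u v t = r2 at *
    generalize eval S.E3 u v t = r3 at *
    generalize eval S.E4 u v t = r4 at *
    generalize ((S.q0 : ℝ) * u + S.p0) * (1 - u) = a1 at *
    generalize ((S.q0 : ℝ) * v + S.p0) * (1 - v) = a2 at *
    generalize (1 + t) * (1 - 2 * t) = a3 at *
    generalize 1 + 2 * u * v * t - u ^ 2 - v ^ 2 - t ^ 2 = a4 at *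
    have p1 := mul_nonneg (add_nonneg gu gv) e1
    have p2 := mul_nonneg (mul_nonneg gu gv) e2
    have p3 := mul_nonneg gt e3
    have p4' := mul_nonneg hgram e4
    linarith
  have htgt : 0 ≤ eval S.target2 u v t := by
    have := (abs_le.1 hres).1
    linarith
  rw [X2SOSCert.target2, eval_smul, eval_append, eval_C, eval_neg] at htgt
  push_cast at htgt
  have hl2' : (0 : ℝ) < S.lam2 := by exact_mod_cast hl2
  have hP' : eval S.PpI u v t ≤ (S.CI2 : ℝ) := by
    have h' : 0 ≤ (S.lam2 : ℝ) * ((S.CI2 : ℝ) - eval S.PpI u v t) := by linarith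
    have := (mul_nonneg_iff_of_pos_left hl2').1 h'
    linarith
  have hbr := abs_eval_le_of_residualBound _ _ hb hu1 hv1 ht1
  rw [eval_append, eval_smul, eval_neg, eval_smul,
    eval_pair_expansion c LK L DK KI PI hK hKI hX hPI u v t hu1 hv1 ht1] at hbr
  push_cast at hbr
  have hb2 := (abs_le.1 hbr).2
  have hDK' : (0 : ℝ) < DK := by exact_mod_cast hDK
  have h2B : (0 : ℝ) < 2 ^ S.B0 := pow_pos (by norm_num) _
  have hlamR : (lam : ℝ) * ((DK : ℝ) * 2 ^ S.B0) ≤ -((DK : ℝ) * S.CI2 + S.delB2) := by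
    have h' : ((lam * ((DK * 2 ^ S.B0 : ℕ) : ℚ) : ℚ) : ℝ) ≤
        ((-((DK : ℚ) * S.CI2 + S.delB2) : ℚ) : ℝ) := by exact_mod_cast hlam
    push_cast at h'
    exact h'
  have hDKK : (DK : ℝ) * eval S.PpI u v t ≤ (DK : ℝ) * (S.CI2 : ℝ) :=
    mul_le_mul_of_nonneg_left hP' hDK'.le
  have key : c.pairPoly u v t * ((DK : ℝ) * 2 ^ S.B0) ≤ (-(lam : ℝ)) * ((DK : ℝ) * 2 ^ S.B0) := by
    have e1 : c.pairPoly u v t * ((DK : ℝ) * 2 ^ S.B0) = (2 ^ S.B0 : ℝ) * ((DK : ℝ) * c.pairPoly u v t) := by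
      ring
    rw [e1]; linarith
  have hpos : (0 : ℝ) < (DK : ℝ) * 2 ^ S.B0 := mul_pos hDK' h2B
  have := le_of_mul_le_mul_right key hpos
  simpa using this

set_option maxHeartbeats 800000 in
/-- **Soundness of (III)**: an `X2SOSCert` passing `check3`, `bridge3` and `side3`, with validated Gram
expansions and a validated triple expansion, proves `c.IneqIII (1/2) eps3`. [folklore] -/
theorem ineqIII_of_x2sos (c : X2Cert) (L : X2Link) (DK : ℕ) (SI : SPoly)
    (S : X2SOSCert) (r0 r1 r2 r3 r4 : GramBlk) (eps3 : ℚ)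
    (hX : linkCheckX c L DK = true) (hSI : PoleSValid (L.blocks c.KX c.RX) SI)
    (h0 : RValid r0 S.R0) (h1 : RValid r1 S.R1) (h2 : RValid r2 S.R2) (h3 : RValid r3 S.R3)
    (h4 : RValid r4 S.R4) (hb : S.bridge3 DK SI = true) (hc : S.check3 = true)
    (hs : S.side3 DK eps3 = true) : c.IneqIII (1 / 2) eps3 := by
  simp only [X2SOSCert.side3, Bool.and_eq_true, decide_eq_true_eq] at hs
  obtain ⟨⟨hDK, hl3⟩, heps⟩ := hs
  intro u v t hu hu' hv hv' ht ht' hgram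
  have hu1 := abs_le_one_of_R3 u hu hu'
  have hv1 := abs_le_one_of_R3 v hv hv'
  have ht1 := abs_le_one_of_R3 t ht ht'
  have gu := ptMult_nonneg u hu hu'
  have gv := ptMult_nonneg v hv hv'
  have gt := ptMult_nonneg t ht ht'
  have hres := abs_eval_le_of_residualBound _ _ hc hu1 hv1 ht1
  rw [eval_mergeAll] at hres
  simp only [List.map_cons, List.map_nil, List.sum_cons, List.sum_nil, add_zero, eval_neg, eval_C,
    Int.cast_natCast] at hres
  have hrhs : 0 ≤ eval S.rhs3 u v t := by
    have e0 := eval_nonneg_of_rvalid r0 S.R0 h0 u v t hu1 hv1 ht1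
    have e1 := eval_nonneg_of_rvalid r1 S.R1 h1 u v t hu1 hv1 ht1
    have e2 := eval_nonneg_of_rvalid r2 S.R2 h2 u v t hu1 hv1 ht1
    have e3 := eval_nonneg_of_rvalid r3 S.R3 h3 u v t hu1 hv1 ht1
    have e4 := eval_nonneg_of_rvalid r4 S.R4 h4 u v t hu1 hv1 ht1
    rw [X2SOSCert.rhs3, eval_mergeAll]
    simp only [List.map_cons, List.map_nil, List.sum_cons, List.sum_nil, add_zero, eval_mulN,
      eval_append, eval_ptU, eval_ptV, eval_ptT, eval_p4]
    generalize eval S.R0 u v t = q0 at *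
    generalize eval S.R1 u v t = q1 at *
    generalize eval S.R2 u v t = q2 at *
    generalize eval S.R3 u v t = q3 at *
    generalize eval S.R4 u v t = q4 at *
    generalize (1 + u) * (1 - 2 * u) = a1 at *
    generalize (1 + v) * (1 - 2 * v) = a2 at *
    generalize (1 + t) * (1 - 2 * t) = a3 at *
    generalize 1 + 2 * u * v * t - u ^ 2 - v ^ 2 - t ^ 2 = a4 at *
    have p1 := mul_nonneg (add_nonneg gu gv) e1
    have p2 := mul_nonneg (mul_nonneg gu gv) e2
    have p3 := mul_nonneg gt e3
    have p4' := mul_nonneg hgram e4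
    linarith
  have htgt : 0 ≤ eval S.target3 u v t := by
    have := (abs_le.1 hres).1
    linarith
  rw [X2SOSCert.target3, eval_smul, eval_append, eval_C, eval_neg] at htgt
  push_cast at htgt
  have hl3' : (0 : ℝ) < S.lam3 := by exact_mod_cast hl3
  have hS' : eval S.SpI u v t ≤ (S.CI3 : ℝ) := by
    have h' : 0 ≤ (S.lam3 : ℝ) * ((S.CI3 : ℝ) - eval S.SpI u v t) := by linarith
    have := (mul_nonneg_iff_of_pos_left hl3').1 h'
    linarith
  have hbr := abs_eval_le_of_residualBound _ _ hb hu1 hv1 ht1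
  rw [eval_append, eval_smul, eval_neg, eval_smul, hSI u v t hu1 hv1 ht1,
    poleSval_link c L DK hX] at hbr
  push_cast at hbr
  have hb2 := (abs_le.1 hbr).2
  have hDK' : (0 : ℝ) < DK := by exact_mod_cast hDK
  have h2B : (0 : ℝ) < 2 ^ S.B0 := pow_pos (by norm_num) _
  have hepsR : (DK : ℝ) * S.CI3 + S.delB3 ≤ (eps3 : ℝ) * ((DK : ℝ) * 2 ^ S.B0) := by
    have h' : ((((DK : ℚ) * S.CI3 + S.delB3 : ℚ)) : ℝ) ≤
        ((eps3 * ((DK * 2 ^ S.B0 : ℕ) : ℚ) : ℚ) : ℝ) := by exact_mod_cast heps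
    push_cast at h'
    exact h'
  have hDKK : (DK : ℝ) * eval S.SpI u v t ≤ (DK : ℝ) * (S.CI3 : ℝ) :=
    mul_le_mul_of_nonneg_left hS' hDK'.le
  have key : c.tripleSym u v t * ((DK : ℝ) * 2 ^ S.B0) ≤ (eps3 : ℝ) * ((DK : ℝ) * 2 ^ S.B0) := by
    have e1 : c.tripleSym u v t * ((DK : ℝ) * 2 ^ S.B0) = (2 ^ S.B0 : ℝ) * ((DK : ℝ) * c.tripleSym u v t) := by
      ring
    rw [e1]; linarith
  have hpos : (0 : ℝ) < (DK : ℝ) * 2 ^ S.B0 := mul_pos hDK' h2B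
  exact le_of_mul_le_mul_right key hpos

/-- **An X2 certificate checked by SOS identities is a hole bound**: (N) and (I) (p1's rational /
Taylor-box checks) together with the kernel-checked (II) and (III) above give `NoHole (-c.u₀)`.
[folklore] -/
theorem noHole_of_x2sos (c : X2Cert) (LK : CapLink) (L : X2Link) (DK : ℕ) (KI PI SI : SPoly)
    (S : X2SOSCert) (g0 g1 g2 g3 g4 r0 r1 r2 r3 r4 : GramBlk) (M lam eps3 : ℚ)
    (hN : X2Cert.IneqN M lam eps3) (hI : c.IneqI M)
    (hK : linkCheck c.cap LK DK = true) (hKI : CapFValid (LK.blocks c.cap.L.length c.cap.R) KI)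
    (hX : linkCheckX c L DK = true) (hPI : PolePValid (L.blocks c.KX c.RX) PI)
    (hSI : PoleSValid (L.blocks c.KX c.RX) SI)
    (h0 : RValid g0 S.E0) (h1 : RValid g1 S.E1) (h2 : RValid g2 S.E2) (h3 : RValid g3 S.E3)
    (h4 : RValid g4 S.E4) (k0 : RValid r0 S.R0) (k1 : RValid r1 S.R1) (k2 : RValid r2 S.R2)
    (k3 : RValid r3 S.R3) (k4 : RValid r4 S.R4)
    (hb2 : S.bridge2 DK (KI ++ PI) = true) (hc2 : S.check2 = true) (hs2 : S.side2 c DK lam = true)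
    (hb3 : S.bridge3 DK SI = true) (hc3 : S.check3 = true) (hs3 : S.side3 DK eps3 = true) :
    NoHole (-(c.u0 : ℝ)) :=
  noHole_of_x2Cert c M lam eps3 hN hI
    (ineqII_of_x2sos c LK L DK KI PI S g0 g1 g2 g3 g4 lam hK hKI hX hPI h0 h1 h2 h3 h4 hb2 hc2 hs2)
    (ineqIII_of_x2sos c L DK SI S r0 r1 r2 r3 r4 eps3 hX hSI k0 k1 k2 k3 k4 hb3 hc3 hs3)

end Summit.Ventures.Crystal3D.X2SOS

end
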